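import Summits.CriticalPhenomena.SAWScalingLimit.Theorems.SAWDefectDecoherenceBoundaryClosureRPolygonLocalCornerPin
import HarnessLib

/-!
# Corner geometry: joint surjectivity of two forms, points with small levels, the two rays
(crux `BoundaryClosureR`, stmt-CriticalPhenomena-14004, line `polygon-parity-squeeze`, sub-goal of the
registered stub `polygonLocalIdentity`, K4; registered helper `corner_forms_surjective`)

* `corner_forms_surjective`: two zigzag forms with non-parallel normals take any prescribed pair of
  values at some face (the corner face of `sidePhase_corner`);
* `norm_le_of_levels`: a vector is controlled by its two levels, `‖w‖ ≤ 2(|ℓ_k(w)| + |ℓ_{k'}(w)|)`;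
* `level_pos_of_cap` / `level_neg_of_cup`: on the ray of form `k` of a convex (resp. reflex) corner the
  level in the other frame is positive (resp. negative);
* `corner_side_flat`: the flat ball of form `k` about a point of the ray of form `k`, with its exact
  half-lattice eventually (from `corner_pinning`).

References: folklore.  No definition is introduced.
-/

noncomputable section

open scoped Topology ComplexConjugate
open Filter Set Metric
open Literature.Probability.LatticeModels Literature.Probability.RandomPlanarGeometry
open Literature.Probability.RandomPlanarGeometry.SAW
open Summit.CriticalPhenomena.SAWScalingLimit.Theorems.PickHalfPlane
open Summit.CriticalPhenomena.SAWScalingLimit.Theorems.PolygonParitySqueeze.PhaseGeometry (halfPlane_eq_of_level_eq_zero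
  innerNormal_opp)

namespace Summit.CriticalPhenomena.SAWScalingLimit.Theorems.PolygonParitySqueeze.PolygonLocal

/-! ### 1. Joint surjectivity of two forms -/

/-- **Two zigzag forms with non-parallel normals are jointly surjective** (registered helper
`corner_forms_surjective`): for every `a, b` some face has `zigzagForm k v = a`, `zigzagForm k' v = b`.
[folklore] -/
theorem corner_forms_surjective : ∀ (k k' : Fin 6), innerNormal k' ≠ innerNormal k → innerNormal k' ≠ -innerNormal k → ∀ a b : ℤ, ∃ v : HexVertex, zigzagForm k v = a ∧ zigzagForm k' v = b := by
  intro k k' hne hne' a b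
  fin_cases k
  · refine ⟨(![(![0, 0, b, -b, b - a, -b - a] : Fin 6 → ℤ) k', a], 0), ?_, ?_⟩ <;> fin_cases k' <;>
      (simp_all [zigzagForm, innerNormal_eq, Complex.ext_iff]; try omega)
  · refine ⟨(![(![0, 0, b, -b, b + a, -b + a] : Fin 6 → ℤ) k', -a], 0), ?_, ?_⟩ <;> fin_cases k' <;>
      (simp_all [zigzagForm, innerNormal_eq, Complex.ext_iff]; try omega)
  · refine ⟨(![a, (![b, -b, 0, 0, b - a, -b - a] : Fin 6 → ℤ) k'], 0), ?_, ?_⟩ <;> fin_cases k' <;>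
      (simp_all [zigzagForm, innerNormal_eq, Complex.ext_iff]; try omega)
  · refine ⟨(![-a, (![b, -b, 0, 0, b + a, -b + a] : Fin 6 → ℤ) k'], 0), ?_, ?_⟩ <;> fin_cases k' <;>
      (simp_all [zigzagForm, innerNormal_eq, Complex.ext_iff]; try omega)
  · refine ⟨(![(![a - b, a + b, b, -b, 0, 0] : Fin 6 → ℤ) k', (![b, -b, a - b, a + b, 0, 0] : Fin 6 → ℤ) k'], 0), ?_, ?_⟩ <;>
      fin_cases k' <;> (simp_all [zigzagForm, innerNormal_eq, Complex.ext_iff]; try omega)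
  · refine ⟨(![(![-a - b, -a + b, b, -b, 0, 0] : Fin 6 → ℤ) k', (![b, -b, -a - b, -a + b, 0, 0] : Fin 6 → ℤ) k'], 0), ?_, ?_⟩ <;>
      fin_cases k' <;> (simp_all [zigzagForm, innerNormal_eq, Complex.ext_iff]; try omega)

/-! ### 2. Vectors with small levels are small -/

/-- **A vector is controlled by its levels in two corner frames**:
`‖w‖ ≤ 2(|Re(w conj n_k)| + |Re(w conj n_{k'})|)`. [folklore] -/
theorem norm_le_of_levels {k k' : Fin 6} (hne : innerNormal k' ≠ innerNormal k)
    (hne' : innerNormal k' ≠ -innerNormal k) (w : ℂ) :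
    ‖w‖ ≤ 2 * (|(w * conj (innerNormal k)).re| + |(w * conj (innerNormal k')).re|) := by
  set u : ℂ := w * conj (innerNormal k) with hu
  set c : ℝ := (innerNormal k * conj (innerNormal k')).re with hc
  set sn : ℝ := (innerNormal k * conj (innerNormal k')).im with hsn
  have hsn2 : sn ^ 2 = 3 / 4 := im_mul_conj_sq hne hne'
  have hsnabs : 1 / 2 ≤ |sn| := by nlinarith [abs_nonneg sn, sq_abs sn]
  have hsnpos : 0 < |sn| := lt_of_lt_of_le (by norm_num) hsnabs
  have hcabs : |c| ≤ 1 / 2 := by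
    rcases re_mul_conj_eq_half_or hne hne' with h | h
    · rw [hc, h, abs_of_pos (by norm_num : (0 : ℝ) < 1 / 2)]
    · rw [hc, h, abs_neg, abs_of_pos (by norm_num : (0 : ℝ) < 1 / 2)]
  have hnn : innerNormal k * conj (innerNormal k) = 1 := by
    rw [Complex.mul_conj, Complex.normSq_eq_norm_sq, norm_innerNormal]; norm_num
  have hw : w = u * innerNormal k := by
    rw [hu, mul_assoc, mul_comm (conj (innerNormal k)), hnn, mul_one]
  have hnorm : ‖w‖ = ‖u‖ := by rw [hw, norm_mul, norm_innerNormal, mul_one]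
  -- the second level in terms of `u`
  have hl' : (w * conj (innerNormal k')).re = u.re * c - u.im * sn := by
    rw [hw, mul_assoc, Complex.mul_re, ← hc, ← hsn]
  have him : |u.im| ≤ |u.re| + 2 * |(w * conj (innerNormal k')).re| := by
    have e : u.im * sn = u.re * c - (w * conj (innerNormal k')).re := by rw [hl']; ring
    have h1 : |u.im| * |sn| ≤ |u.re| * |c| + |(w * conj (innerNormal k')).re| := by
      rw [← abs_mul, e]
      calc |u.re * c - (w * conj (innerNormal k')).re| ≤ |u.re * c| + |(w * conj (innerNormal k')).re| := abs_sub _ _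
        _ = |u.re| * |c| + |(w * conj (innerNormal k')).re| := by rw [abs_mul]
    have h2 : |u.im| * (1 / 2) ≤ |u.im| * |sn| := by gcongr
    have h3 : |u.re| * |c| ≤ |u.re| * (1 / 2) := by gcongr
    nlinarith [abs_nonneg u.im, abs_nonneg u.re, abs_nonneg (w * conj (innerNormal k')).re]
  calc ‖w‖ = ‖u‖ := hnorm
    _ ≤ |u.re| + |u.im| := Complex.norm_le_abs_re_add_abs_im u
    _ ≤ 2 * (|u.re| + |(w * conj (innerNormal k')).re|) := by linarith [abs_nonneg u.re]

/-! ### 3. The two rays of a corner -/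

/-- A nonzero vector on the side line of form `k` has a nonzero level in the other frame. [folklore] -/
theorem level_ne_zero_of_ray {k k' : Fin 6} (hne : innerNormal k' ≠ innerNormal k)
    (hne' : innerNormal k' ≠ -innerNormal k) {w : ℂ} (hw : w ≠ 0) (hl : (w * conj (innerNormal k)).re = 0) :
    (w * conj (innerNormal k')).re ≠ 0 := by
  intro h
  have := norm_le_of_levels hne hne' w
  rw [hl, h, abs_zero, add_zero, mul_zero] at this
  exact hw (norm_le_zero_iff.1 this)

/-- **Convex corner: the level in the other frame is positive on the ray.**  If
`P ∩ B(z,s) = H_k ∩ H_{k'} ∩ B(z,s)` and `z₁ ∈ ∂P ∩ B(z, s)` lies on the line of form `k`, `z₁ ≠ z`, then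
`Re((z₁ - z) conj n_{k'}) > 0`. [folklore] -/
theorem level_pos_of_cap {P : Set ℂ} (hP : IsOpen P) {k k' : Fin 6} (hne : innerNormal k' ≠ innerNormal k)
    (hne' : innerNormal k' ≠ -innerNormal k) {z : ℂ} {s : ℝ}
    (hset : P ∩ ball z s = halfPlane k z ∩ halfPlane k' z ∩ ball z s) {z₁ : ℂ} (hz₁ : z₁ ∈ frontier P)
    (hz₁b : z₁ ∈ ball z s) (hz₁ne : z₁ ≠ z) (hl : ((z₁ - z) * conj (innerNormal k)).re = 0) :
    0 < ((z₁ - z) * conj (innerNormal k')).re := by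
  have hne0 := level_ne_zero_of_ray hne hne' (sub_ne_zero.2 hz₁ne) hl
  rw [frontier, Set.mem_sdiff, hP.interior_eq] at hz₁
  have h1 : z₁ ∈ closure (halfPlane k z ∩ halfPlane k' z ∩ ball z s) := by
    rw [← hset, inter_comm]; exact isOpen_ball.inter_closure ⟨hz₁b, hz₁.1⟩
  have h2 : closure (halfPlane k z ∩ halfPlane k' z ∩ ball z s) ⊆ {w : ℂ | 0 ≤ ((w - z) * conj (innerNormal k')).re} :=
    closure_minimal (fun y hy => le_of_lt ((mem_halfPlane_iff_level k' z y).1 hy.1.2))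
      (isClosed_le continuous_const (Complex.continuous_re.comp
        ((continuous_id.sub continuous_const).mul continuous_const)))
  have h3 : 0 ≤ ((z₁ - z) * conj (innerNormal k')).re := h2 h1
  exact lt_of_le_of_ne h3 (Ne.symm hne0)

/-- **Reflex corner: the level in the other frame is negative on the ray.**  If
`P ∩ B(z,s) = (H_k ∪ H_{k'}) ∩ B(z,s)` and `z₁ ∈ ∂P ∩ B(z, s)` lies on the line of form `k`, `z₁ ≠ z`,
then `Re((z₁ - z) conj n_{k'}) < 0`. [folklore] -/
theorem level_neg_of_cup {P : Set ℂ} (hP : IsOpen P) {k k' : Fin 6} (hne : innerNormal k' ≠ innerNormal k)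
    (hne' : innerNormal k' ≠ -innerNormal k) {z : ℂ} {s : ℝ}
    (hset : P ∩ ball z s = (halfPlane k z ∪ halfPlane k' z) ∩ ball z s) {z₁ : ℂ} (hz₁ : z₁ ∈ frontier P)
    (hz₁b : z₁ ∈ ball z s) (hz₁ne : z₁ ≠ z) (hl : ((z₁ - z) * conj (innerNormal k)).re = 0) :
    ((z₁ - z) * conj (innerNormal k')).re < 0 := by
  have hne0 := level_ne_zero_of_ray hne hne' (sub_ne_zero.2 hz₁ne) hl
  rw [frontier, Set.mem_sdiff, hP.interior_eq] at hz₁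
  have h3 : ¬ 0 < ((z₁ - z) * conj (innerNormal k')).re := fun h => by
    have : z₁ ∈ (halfPlane k z ∪ halfPlane k' z) ∩ ball z s := ⟨Or.inr ((mem_halfPlane_iff_level k' z _).2 h), hz₁b⟩
    rw [← hset] at this
    exact hz₁.2 this.1
  push Not at h3
  exact lt_of_le_of_ne h3 hne0

/-! ### 4. The flat ball about a point of a ray -/

/-- **The flat ball of form `k` about a point of the ray of form `k`.**  At an exact corner (continuum
`∩`/`∪`, lattice `∧`/`∨` eventually, with thresholds pinned by `corner_pinning`), for `z₁ ∈ ∂P ∩ B(z,s)`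
on the line of form `k`, `z₁ ≠ z`, the ball `B(z₁, s₁)` with
`s₁ = min (s - dist z₁ z) |Re((z₁ - z) conj n_{k'})| / 2` is a flat ball of form `k`: inside `B(z, s)`,
carrier `= H_k(z₁)`, eventually the exact half-lattice `{nk ≤ zigzagForm k}`. [folklore] -/
theorem corner_side_flat {D : DobrushinDomain} {ρ : ℝ} {Λ : ℝ → Finset HexVertex} {m : ℝ → ℤ}
    {b : ℝ → Sym2 HexVertex} (hAF : AdmissibleFamily D ρ Λ m b) {z : ℂ} {k k' : Fin 6} {s : ℝ} (hs : 0 < s)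
    (hne : innerNormal k' ≠ innerNormal k) (hne' : innerNormal k' ≠ -innerNormal k)
    (hsetC : D.carrier ∩ ball z s = halfPlane k z ∩ halfPlane k' z ∩ ball z s ∨
      D.carrier ∩ ball z s = (halfPlane k z ∪ halfPlane k' z) ∩ ball z s)
    (hexC : ∀ᶠ δ : ℝ in 𝓝[>] 0, ∃ nk nk' : ℤ,
      (∀ v : HexVertex, (δ : ℂ) * hexCenter v ∈ ball z s → (v ∈ Λ δ ↔ (nk ≤ zigzagForm k v ∧ nk' ≤ zigzagForm k' v))) ∨
      (∀ v : HexVertex, (δ : ℂ) * hexCenter v ∈ ball z s → (v ∈ Λ δ ↔ (nk ≤ zigzagForm k v ∨ nk' ≤ zigzagForm k' v))))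
    {z₁ : ℂ} (hz₁ : z₁ ∈ frontier D.carrier) (hz₁b : z₁ ∈ ball z s) (hz₁ne : z₁ ≠ z)
    (hl : ((z₁ - z) * conj (innerNormal k)).re = 0) :
    0 < min (s - dist z₁ z) |((z₁ - z) * conj (innerNormal k')).re| / 2 ∧
    ball z₁ (min (s - dist z₁ z) |((z₁ - z) * conj (innerNormal k')).re| / 2) ⊆ ball z s ∧
    D.carrier ∩ ball z₁ (min (s - dist z₁ z) |((z₁ - z) * conj (innerNormal k')).re| / 2) =
      halfPlane k z₁ ∩ ball z₁ (min (s - dist z₁ z) |((z₁ - z) * conj (innerNormal k')).re| / 2) ∧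
    (∀ᶠ δ : ℝ in 𝓝[>] 0, ∃ nthr : ℤ, ∀ v : HexVertex,
      (δ : ℂ) * hexCenter v ∈ ball z₁ (min (s - dist z₁ z) |((z₁ - z) * conj (innerNormal k')).re| / 2) →
      (v ∈ Λ δ ↔ nthr ≤ zigzagForm k v)) := by
  set L : ℝ := ((z₁ - z) * conj (innerNormal k')).re with hL
  set s₁ : ℝ := min (s - dist z₁ z) |L| / 2 with hs₁
  have hL0 : L ≠ 0 := level_ne_zero_of_ray hne hne' (sub_ne_zero.2 hz₁ne) hl
  have hd : dist z₁ z < s := mem_ball.1 hz₁b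
  have hs₁0 : 0 < s₁ := by
    have : 0 < min (s - dist z₁ z) |L| := lt_min (by linarith) (abs_pos.2 hL0)
    rw [hs₁]; linarith
  have hs₁d : s₁ ≤ (s - dist z₁ z) / 2 := by
    have := min_le_left (s - dist z₁ z) |L|; rw [hs₁]; linarith
  have hs₁L : s₁ ≤ |L| / 2 := by
    have := min_le_right (s - dist z₁ z) |L|; rw [hs₁]; linarith
  have hsub : ball z₁ s₁ ⊆ ball z s := fun w hw => by
    rw [mem_ball] at hw ⊢; have := dist_triangle w z₁ z; linarith
  -- levels in the frame `k'` keep the sign of `L` on `B(z₁, s₁)`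
  have hlev : ∀ w ∈ ball z₁ s₁, |((w - z) * conj (innerNormal k')).re - L| < |L| / 2 := fun w hw => by
    have h1 := abs_level_le_dist k' z₁ w
    have e : ((w - z) * conj (innerNormal k')).re - L = ((w - z₁) * conj (innerNormal k')).re := by
      rw [hL, ← Complex.sub_re, ← sub_mul, sub_sub_sub_cancel_right]
    rw [e]; rw [mem_ball] at hw; linarith
  refine ⟨hs₁0, hsub, ?_, ?_⟩
  · -- the set equation
    rw [halfPlane_eq_of_level_eq_zero hl]
    ext w
    constructor
    · rintro ⟨hwD, hwb⟩
      have : w ∈ D.carrier ∩ ball z s := ⟨hwD, hsub hwb⟩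
      rcases hsetC with h | h
      · rw [h] at this; exact ⟨this.1.1, hwb⟩
      · rw [h] at this
        rcases this.1 with h' | h'
        · exact ⟨h', hwb⟩
        · exfalso
          have hneg := level_neg_of_cup D.isOpen hne hne' h hz₁ hz₁b hz₁ne hl
          have h1 := (mem_halfPlane_iff_level k' z w).1 h'
          have h2 := hlev w hwb
          rw [abs_of_neg hneg] at h2
          have := (abs_lt.1 h2).2
          linarith
    · rintro ⟨hwH, hwb⟩
      refine ⟨?_, hwb⟩
      rcases hsetC with h | h
      · have hpos := level_pos_of_cap D.isOpen hne hne' h hz₁ hz₁b hz₁ne hl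
        have h2 := hlev w hwb
        rw [abs_of_pos hpos] at h2
        have hw' : w ∈ halfPlane k' z := (mem_halfPlane_iff_level k' z w).2 (by have := (abs_lt.1 h2).1; linarith)
        have : w ∈ halfPlane k z ∩ halfPlane k' z ∩ ball z s := ⟨⟨hwH, hw'⟩, hsub hwb⟩
        rw [← h] at this; exact this.1
      · have : w ∈ (halfPlane k z ∪ halfPlane k' z) ∩ ball z s := ⟨Or.inl hwH, hsub hwb⟩
        rw [← h] at this; exact this.1
  · -- the exact half-lattice, eventually
    have hpin := corner_pinning D ρ Λ m b hAF z k k' s hs hne hne' hsetC (s₁ / 4) (by linarith)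
    have hsmall : ∀ᶠ δ : ℝ in 𝓝[>] 0, δ < s₁ / 4 := nhdsWithin_le_nhds (eventually_lt_nhds (by linarith))
    filter_upwards [hexC, hpin, hsmall, self_mem_nhdsWithin] with δ ⟨nk, nk', hform⟩ hp hδs hδ0
    have hδ0 : (0 : ℝ) < δ := hδ0
    obtain ⟨hpA, hpO⟩ := hp nk nk'
    refine ⟨nk, fun v hv => ?_⟩
    have hvb : (δ : ℂ) * hexCenter v ∈ ball z s := hsub hv
    have hvlev := hlev _ hv
    rcases hform with hform | hform
    · obtain ⟨hcap, -, hA'⟩ := hpA hform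
      have hpos := level_pos_of_cap D.isOpen hne hne' hcap hz₁ hz₁b hz₁ne hl
      rw [abs_of_pos hpos] at hvlev hs₁L
      have hk' : nk' ≤ zigzagForm k' v := threshold_le_form_of_level hδ0 k' v nk' z (by
        have h1 := (abs_le.1 hA').2
        have h2 := (abs_lt.1 hvlev).1
        linarith)
      rw [hform v hvb]
      exact ⟨fun h => h.1, fun h => ⟨h, hk'⟩⟩
    · obtain ⟨hcup, -, hA'⟩ := hpO hform
      have hneg := level_neg_of_cup D.isOpen hne hne' hcup hz₁ hz₁b hz₁ne hl
      rw [abs_of_neg hneg] at hvlev hs₁L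
      have hk' : ¬ nk' ≤ zigzagForm k' v := not_threshold_le_form_of_level hδ0 k' v nk' z (by
        have h1 := (abs_le.1 hA').1
        have h2 := (abs_lt.1 hvlev).2
        linarith)
      rw [hform v hvb]
      exact ⟨fun h => h.resolve_right hk', fun h => Or.inl h⟩

end Summit.CriticalPhenomena.SAWScalingLimit.Theorems.PolygonParitySqueeze.PolygonLocal

end
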